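import Literature.Probability.LatticeModels.EdgeFirstExit
import Literature.Probability.Percolation.LatticePathArcs
import HarnessLib

/-!
# The wall polyline of two lattice walks ending at death sites

Sub-problem `CriticalPhenomena/SAWScalingLimit`, crux `AvoidanceLimit`
(`Summit.CriticalPhenomena.SAWScalingLimit.Theses.SAWLoopFugacityFlow.AvoidanceLimit`,
stmt-CriticalPhenomena-10649), line `symplectic-fermion-anchor` (lead c7), helpers of the stub
`walls_separate` (Chelkak 2016, Prop. 3.3: "due to topological reasons, the walk should cross at least
one of those two paths"). Planar geometry of the continuum wall built from two kept lattice walks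
`pT : zc → xT`, `pB : zc → xB` of `Ω^δ = discreteDomainGraph D.carrier δ` ending at death sites with
dying lattice directions `eT`, `eB` (landing points `q = edgeLanding`, `EdgeFirstExit.lean`):

* `exitSegment_inter_segment`, `exitSegment_inter_exitSegment` — the initial piece `[δy, q]` of a dying
  lattice edge up to its landing point meets another closed lattice edge with ends in `Ω`, or another
  such initial piece with a different landing point, only at `δy` (lattice edges meet only at lattice
  points, `exists_eq_toComplex_of_mem_edgeTrace_inter`; the far end lies on the initial piece only if
  it is the landing point, which is off `Ω`; a fjord of width `< δ` run from both ends has disjoint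
  initial pieces, `lineMap_mem_of_lt_firstExitParam`);
* `exists_wall_arc` — `Λ = [q_T, δxT] ∪ meshTrace (lattice path xT → xB inside the supports) ∪ [δxB, q_B]`
  is a simple arc from `q_T` to `q_B` in `D̄` (`Walk.bypass`, `isSimpleArc_walkTrace`, gluing
  `IsSimpleArc.union`), every point within `δ` of a wall site, and grid-compatible: an edge of `Ω^δ`
  whose closed segment meets `Λ` has an end on the wall (`exists_mem_support_of_meshTrace_inter_nonempty`).

[cite: Chelkak2016, Proposition 3.3]
-/

noncomputable section

open Set Metric AffineMap
open Literature.Topology.PlaneTopology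
open Literature.Probability.LatticeModels
open Literature.Probability.RandomPlanarGeometry (JordanDomain)
open Literature.Probability.Percolation (edgeTrace meshScale meshTrace meshScale_apply
  segment_meshPoint_eq_image exists_eq_toComplex_of_mem_edgeTrace_inter meshPoint_eq_meshScale
  mem_meshTrace_iff exists_mem_support_of_meshTrace_inter_nonempty isSimpleArc_walkTrace
  dist_meshPoint_of_adj)

namespace Summit.CriticalPhenomena.SAWScalingLimit.Theorems.AvoidanceLimit.Anchor

/-! ### Exit sub-segments of dying lattice edges against the grid -/

/-- Scaling by a non-zero mesh is injective. [folklore] -/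
theorem meshScale_injective {δ : ℝ} (hδ : δ ≠ 0) : Function.Injective (meshScale δ) := by
  intro z w h
  rw [meshScale_apply, meshScale_apply] at h
  exact mul_left_cancel₀ (Complex.ofReal_ne_zero.2 hδ) h

/-- If the far end `q` of the segment `[p, q]` lies on the initial piece up to the first exit
point (first exit parameter positive), the first exit point is `q`. [folklore] -/
theorem firstExitPoint_eq_of_mem_segment {Ω : Set ℂ} {p q : ℂ} (hpq : p ≠ q)
    (h0 : 0 < firstExitParam Ω p q) (h : q ∈ segment ℝ p (firstExitPoint Ω p q)) :
    firstExitPoint Ω p q = q := by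
  rw [segment_eq_image_lineMap] at h
  obtain ⟨θ, hθ, hq⟩ := h
  rw [firstExitPoint, lineMap_lineMap_right] at hq
  have h1 : θ * firstExitParam Ω p q = 1 := by
    apply lineMap_injective ℝ hpq
    rw [hq, lineMap_apply_one]
  have hle := firstExitParam_le_one (Ω := Ω) (p := p) (q := q)
  have hτ : firstExitParam Ω p q = 1 := by nlinarith [hθ.1, hθ.2]
  rw [firstExitPoint, hτ, lineMap_apply_one]

/-- **An exit sub-segment meets a lattice edge with ends in `Ω` only at its start.** Let the
lattice edge `y → y + e` leave the open set `Ω ∋ δy`, and let `[δa, δc]` be a *different*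
lattice edge with both ends in `Ω`. A common point of the initial piece `[δy, q]` of the first
edge up to its landing point `q` and of `[δa, δc]` is `δy`, and then `y ∈ {a, c}` (two lattice
edges meet only at a common end; the end `δ(y + e)` lies on `[δy, q]` only if `q = δ(y + e)`,
which is off `Ω`). [folklore] -/
theorem exitSegment_inter_segment {Ω : Set ℂ} (hΩ : IsOpen Ω) {δ : ℝ} (hδ : 0 < δ)
    {y : Site 2} {e : SRW.Dir 2} (hy : meshPoint δ y ∈ Ω)
    (hye : ¬ segment ℝ (meshPoint δ y) (meshPoint δ (y + SRW.stepVec e)) ⊆ Ω)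
    {a c : Site 2} (hac : (zdGraph 2).Adj a c) (ha : meshPoint δ a ∈ Ω) (hc : meshPoint δ c ∈ Ω)
    (hne : s(y, y + SRW.stepVec e) ≠ s(a, c)) {z : ℂ}
    (hz : z ∈ segment ℝ (meshPoint δ y) (edgeLanding Ω δ y e))
    (hz' : z ∈ segment ℝ (meshPoint δ a) (meshPoint δ c)) :
    z = meshPoint δ y ∧ (y = a ∨ y = c) := by
  have hq : edgeLanding Ω δ y e ∉ Ω := firstExitPoint_not_mem hΩ hye
  have hsub : segment ℝ (meshPoint δ y) (edgeLanding Ω δ y e) ⊆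
      segment ℝ (meshPoint δ y) (meshPoint δ (y + SRW.stepVec e)) :=
    (convex_segment _ _).segment_subset (left_mem_segment ℝ _ _) edgeLanding_mem_segment
  have hz₁ : z ∈ meshScale δ '' edgeTrace s(y, y + SRW.stepVec e) := by
    rw [← segment_meshPoint_eq_image]; exact hsub hz
  have hz₂ : z ∈ meshScale δ '' edgeTrace s(a, c) := by
    rw [← segment_meshPoint_eq_image]; exact hz'
  obtain ⟨z₁, hz₁m, rfl⟩ := hz₁
  obtain ⟨z₂, hz₂m, h12⟩ := hz₂
  obtain rfl : z₂ = z₁ := meshScale_injective hδ.ne' h12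
  obtain ⟨x, hx, hxe, hxe'⟩ :=
    exists_eq_toComplex_of_mem_edgeTrace_inter (zdGraph_adj_add_stepVec y e) hac hne hz₁m hz₂m
  subst hx
  rcases Sym2.mem_iff.1 hxe with rfl | rfl
  · exact ⟨(meshPoint_eq_meshScale δ _).symm, Sym2.mem_iff.1 hxe'⟩
  · exfalso
    have hmem : meshPoint δ (y + SRW.stepVec e) ∈ segment ℝ (meshPoint δ y) (edgeLanding Ω δ y e) := by
      rw [← meshPoint_eq_meshScale] at hz; exact hz
    have hpq : meshPoint δ y ≠ meshPoint δ (y + SRW.stepVec e) := by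
      intro h
      have := dist_meshPoint_add_stepVec δ y e
      rw [h, dist_self, abs_of_pos hδ] at this
      exact hδ.ne' this.symm
    have hq' : edgeLanding Ω δ y e = meshPoint δ (y + SRW.stepVec e) :=
      firstExitPoint_eq_of_mem_segment hpq (firstExitParam_pos hΩ hy hye) hmem
    apply hq
    rw [hq']
    rcases Sym2.mem_iff.1 hxe' with h | h
    · rw [h]; exact ha
    · rw [h]; exact hc

/-- **Two exit sub-segments with different landing points meet only at a common start.** If the
lattice edges `y → y + e`, `y' → y' + e'` leave the open set `Ω ∋ δy, δy'` with different landing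
points `q ≠ q'`, a common point of the initial pieces `[δy, q]`, `[δy', q']` is `δy = δy'`
(different edges meet only at a common end, and a far end `δ(y + e) ∈ [δy, q]` forces
`q = δ(y + e)`; the same edge run in opposite directions — a fjord of width `< δ` — has disjoint
initial pieces, as `[δy, q) ⊆ Ω ∌ q'` and `[δy', q') ⊆ Ω ∌ q`). [folklore] -/
theorem exitSegment_inter_exitSegment {Ω : Set ℂ} (hΩ : IsOpen Ω) {δ : ℝ} (hδ : 0 < δ)
    {y y' : Site 2} {e e' : SRW.Dir 2} (hy : meshPoint δ y ∈ Ω)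
    (hye : ¬ segment ℝ (meshPoint δ y) (meshPoint δ (y + SRW.stepVec e)) ⊆ Ω)
    (hy' : meshPoint δ y' ∈ Ω)
    (hye' : ¬ segment ℝ (meshPoint δ y') (meshPoint δ (y' + SRW.stepVec e')) ⊆ Ω)
    (hne : edgeLanding Ω δ y e ≠ edgeLanding Ω δ y' e') {z : ℂ}
    (hz : z ∈ segment ℝ (meshPoint δ y) (edgeLanding Ω δ y e))
    (hz' : z ∈ segment ℝ (meshPoint δ y') (edgeLanding Ω δ y' e')) :
    z = meshPoint δ y ∧ y = y' := by
  have hq : edgeLanding Ω δ y e ∉ Ω := firstExitPoint_not_mem hΩ hye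
  have hq' : edgeLanding Ω δ y' e' ∉ Ω := firstExitPoint_not_mem hΩ hye'
  have hpq : ∀ (v : Site 2) (f : SRW.Dir 2), meshPoint δ v ≠ meshPoint δ (v + SRW.stepVec f) := by
    intro v f h
    have := dist_meshPoint_add_stepVec δ v f
    rw [h, dist_self, abs_of_pos hδ] at this
    exact hδ.ne' this.symm
  by_cases hee : s(y, y + SRW.stepVec e) = s(y', y' + SRW.stepVec e')
  · rcases Sym2.eq_iff.1 hee with ⟨h1, h2⟩ | ⟨h1, h2⟩
    · exact absurd (by simp only [edgeLanding, h2]; rw [h1]) hne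
    · -- the fjord: the same edge in opposite directions
      exfalso
      have e1 : meshPoint δ (y + SRW.stepVec e) = meshPoint δ y' := by rw [h2]
      have e2 : meshPoint δ (y' + SRW.stepVec e') = meshPoint δ y := by rw [← h1]
      have hpp' : meshPoint δ y ≠ meshPoint δ y' := e1 ▸ hpq y e
      have hqe : edgeLanding Ω δ y e = firstExitPoint Ω (meshPoint δ y) (meshPoint δ y') := by
        rw [edgeLanding, e1]
      have hqe' : edgeLanding Ω δ y' e' = firstExitPoint Ω (meshPoint δ y') (meshPoint δ y) := by
        rw [edgeLanding, e2]
      have hτ₁0 : 0 ≤ firstExitParam Ω (meshPoint δ y) (meshPoint δ y') := firstExitParam_nonneg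
      have hτ₂0 : 0 ≤ firstExitParam Ω (meshPoint δ y') (meshPoint δ y) := firstExitParam_nonneg
      rw [hqe, firstExitPoint, segment_eq_image_lineMap] at hz
      rw [hqe', firstExitPoint, segment_eq_image_lineMap] at hz'
      obtain ⟨θ₁, hθ₁, rfl⟩ := hz
      obtain ⟨θ₂, hθ₂, h12⟩ := hz'
      rw [lineMap_lineMap_right, lineMap_lineMap_right, ← lineMap_apply_one_sub] at h12
      have hpar := lineMap_injective ℝ hpp' h12
      have a1 := mul_le_of_le_one_left hτ₁0 hθ₁.2
      have a2 := mul_le_of_le_one_left hτ₂0 hθ₂.2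
      have hle : 1 - firstExitParam Ω (meshPoint δ y) (meshPoint δ y') ≤
          firstExitParam Ω (meshPoint δ y') (meshPoint δ y) := by linarith
      rcases hle.lt_or_eq with hlt | heq
      · apply hq
        rw [hqe, firstExitPoint, ← lineMap_apply_one_sub]
        exact lineMap_mem_of_lt_firstExitParam
          ⟨by linarith [(firstExitParam_le_one : firstExitParam Ω (meshPoint δ y) (meshPoint δ y') ≤ 1)],
            hlt⟩
      · apply hne
        rw [hqe, hqe', firstExitPoint, firstExitPoint, ← lineMap_apply_one_sub, heq]
  · -- two different edges
    have hsub : ∀ (v : Site 2) (f : SRW.Dir 2), segment ℝ (meshPoint δ v) (edgeLanding Ω δ v f) ⊆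
        meshScale δ '' edgeTrace s(v, v + SRW.stepVec f) := fun v f => by
      rw [← segment_meshPoint_eq_image]
      exact (convex_segment _ _).segment_subset (left_mem_segment ℝ _ _) edgeLanding_mem_segment
    obtain ⟨z₁, hz₁m, rfl⟩ := hsub y e hz
    obtain ⟨z₂, hz₂m, h12⟩ := hsub y' e' hz'
    obtain rfl : z₂ = z₁ := meshScale_injective hδ.ne' h12
    obtain ⟨x, hx, hxe, hxe'⟩ := exists_eq_toComplex_of_mem_edgeTrace_inter
      (zdGraph_adj_add_stepVec y e) (zdGraph_adj_add_stepVec y' e') hee hz₁m hz₂m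
    subst hx
    have key : ∀ (v : Site 2) (f : SRW.Dir 2), meshPoint δ v ∈ Ω →
        ¬ segment ℝ (meshPoint δ v) (meshPoint δ (v + SRW.stepVec f)) ⊆ Ω →
        meshScale δ (Site.toComplex (v + SRW.stepVec f)) ∈
          segment ℝ (meshPoint δ v) (edgeLanding Ω δ v f) →
        edgeLanding Ω δ v f = meshPoint δ (v + SRW.stepVec f) := fun v f hv hvf hmem =>
      firstExitPoint_eq_of_mem_segment (hpq v f) (firstExitParam_pos hΩ hv hvf)
        (by rw [← meshPoint_eq_meshScale] at hmem; exact hmem)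
    rcases Sym2.mem_iff.1 hxe with rfl | rfl <;> rcases Sym2.mem_iff.1 hxe' with h | h
    · exact ⟨(meshPoint_eq_meshScale δ _).symm, h⟩
    · exfalso
      rw [h] at hz'
      exact hq' (by rw [key y' e' hy' hye' hz', ← h]; exact hy)
    · exfalso
      have := key y e hy hye hz
      exact hq (by rw [this, h]; exact hy')
    · exfalso
      have h₁ := key y e hy hye hz
      rw [h] at hz'
      have h₂ := key y' e' hy' hye' hz'
      exact hne (by rw [h₁, h₂, h])

/-! ### The wall polyline -/

/-- **The wall polyline.** For two walks `pT : zc → xT`, `pB : zc → xB` of `Ω^δ` through sites of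
`Ω_δ`, dying lattice directions `eT` at `xT` and `eB` at `xB` with different landing points
`q_T ≠ q_B`, the set `Λ = [q_T, δxT] ∪ (mesh trace of a lattice path from xT to xB inside the two
supports) ∪ [δxB, q_B]` is a simple arc from `q_T` to `q_B` inside `D̄`, through `δxT`, every
point of which is within `δ` of a site of the two supports, and every edge of `Ω^δ` whose closed
segment meets `Λ` has an end on the two supports (lattice edges meet only at lattice points; the
far end of a dying edge lies on its initial piece only if it is the landing point, which is off
`D`). [folklore] -/
theorem exists_wall_arc :
    ∀ (D : JordanDomain) (δ : ℝ), 0 < δ → ∀ (zc xT xB : Site 2)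
      (pT : (discreteDomainGraph D.carrier δ).Walk zc xT) (pB : (discreteDomainGraph D.carrier δ).Walk zc xB)
      (eT eB : SRW.Dir 2),
      ¬ (discreteDomainGraph D.carrier δ).Adj xT (xT + SRW.stepVec eT) →
      ¬ (discreteDomainGraph D.carrier δ).Adj xB (xB + SRW.stepVec eB) →
      edgeLanding D.carrier δ xT eT ≠ edgeLanding D.carrier δ xB eB →
      (∀ v, v ∈ pT.support ∨ v ∈ pB.support → v ∈ meshDomain D.carrier δ) →
    ∃ Λ : Set ℂ, IsSimpleArc Λ (edgeLanding D.carrier δ xT eT) (edgeLanding D.carrier δ xB eB) ∧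
      Λ ⊆ closure D.carrier ∧ meshPoint δ xT ∈ Λ ∧
      (∀ z ∈ Λ, ∃ v, (v ∈ pT.support ∨ v ∈ pB.support) ∧ dist z (meshPoint δ v) ≤ δ) ∧
      (∀ a c, (discreteDomainGraph D.carrier δ).Adj a c →
        (segment ℝ (meshPoint δ a) (meshPoint δ c) ∩ Λ).Nonempty →
        (a ∈ pT.support ∨ a ∈ pB.support) ∨ (c ∈ pT.support ∨ c ∈ pB.support)) := by
  intro D δ hδ zc xT xB pT pB eT eB hT hB hne hW
  have hle : discreteDomainGraph D.carrier δ ≤ zdGraph 2 :=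
    (discreteDomainGraph_le_meshGraph _ _).trans (meshGraph_le_zdGraph _ _)
  have hsite : ∀ v, v ∈ pT.support ∨ v ∈ pB.support → meshPoint δ v ∈ D.carrier := fun v hv =>
    meshDomain_subset_meshVertices _ _ (hW v hv)
  have hxTW : xT ∈ pT.support ∨ xT ∈ pB.support := Or.inl pT.end_mem_support
  have hxBW : xB ∈ pT.support ∨ xB ∈ pB.support := Or.inr pB.end_mem_support
  have hxTD := hsite xT hxTW
  have hxBD := hsite xB hxBW
  have hsegT : ¬ segment ℝ (meshPoint δ xT) (meshPoint δ (xT + SRW.stepVec eT)) ⊆ D.carrier :=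
    not_segment_subset_of_not_discreteDomainGraph_adj (hW xT hxTW) (zdGraph_adj_add_stepVec xT eT) hT
  have hsegB : ¬ segment ℝ (meshPoint δ xB) (meshPoint δ (xB + SRW.stepVec eB)) ⊆ D.carrier :=
    not_segment_subset_of_not_discreteDomainGraph_adj (hW xB hxBW) (zdGraph_adj_add_stepVec xB eB) hB
  have hqTfr : edgeLanding D.carrier δ xT eT ∈ frontier D.carrier :=
    edgeLanding_mem_frontier_of_not_adj D.isOpen (hW xT hxTW) hT
  have hqBfr : edgeLanding D.carrier δ xB eB ∈ frontier D.carrier :=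
    edgeLanding_mem_frontier_of_not_adj D.isOpen (hW xB hxBW) hB
  have hqTD : edgeLanding D.carrier δ xT eT ∉ D.carrier := firstExitPoint_not_mem D.isOpen hsegT
  have hqBD : edgeLanding D.carrier δ xB eB ∉ D.carrier := firstExitPoint_not_mem D.isOpen hsegB
  have hqTne : meshPoint δ xT ≠ edgeLanding D.carrier δ xT eT := fun h => hqTD (h ▸ hxTD)
  have hqBne : meshPoint δ xB ≠ edgeLanding D.carrier δ xB eB := fun h => hqBD (h ▸ hxBD)
  -- a lattice path from `xT` to `xB` inside the two supports, read in `ℤ²`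
  set P := (pT.reverse.append pB).bypass with hP
  have hPsupp : ∀ v ∈ P.support, v ∈ pT.support ∨ v ∈ pB.support := fun v hv => by
    have h := SimpleGraph.Walk.support_bypass_subset_support _ hv
    rwa [SimpleGraph.Walk.mem_support_append_iff, SimpleGraph.Walk.support_reverse,
      List.mem_reverse] at h
  have hPE : ∀ e ∈ P.edges, e ∈ (zdGraph 2).edgeSet := fun e he =>
    SimpleGraph.edgeSet_mono hle (P.edges_subset_edgeSet he)
  set P' := P.transfer (zdGraph 2) hPE with hP'
  have hP'path : P'.IsPath := (SimpleGraph.Walk.bypass_isPath _).transfer hPE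
  have hP'supp : ∀ v ∈ P'.support, v ∈ pT.support ∨ v ∈ pB.support := fun v hv =>
    hPsupp v (by rwa [SimpleGraph.Walk.support_transfer] at hv)
  have hP'edges : ∀ {a c : Site 2}, s(a, c) ∈ P'.edges →
      (discreteDomainGraph D.carrier δ).Adj a c := fun he =>
    P.adj_of_mem_edges (by rwa [SimpleGraph.Walk.edges_transfer] at he)
  -- points of the mesh trace lie on the closed mesh edges of the path
  have hMseg : ∀ z ∈ meshTrace δ P', ∃ a c : Site 2, s(a, c) ∈ P'.edges ∧
      z ∈ segment ℝ (meshPoint δ a) (meshPoint δ c) := by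
    intro z hz
    obtain ⟨e, he, hze⟩ := mem_meshTrace_iff.1 hz
    obtain ⟨a, c, rfl⟩ : ∃ a c, e = s(a, c) := by
      induction e using Sym2.ind with
      | h a c => exact ⟨a, c, rfl⟩
    exact ⟨a, c, he, by rw [segment_meshPoint_eq_image]; exact hze⟩
  have hEsite : ∀ {a c : Site 2}, s(a, c) ∈ P'.edges →
      (a ∈ pT.support ∨ a ∈ pB.support) ∧ (c ∈ pT.support ∨ c ∈ pB.support) := fun he =>
    ⟨hP'supp _ (P'.fst_mem_support_of_mem_edges he), hP'supp _ (P'.snd_mem_support_of_mem_edges he)⟩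
  -- the three pieces and their pairwise intersections
  have hAT : IsSimpleArc (segment ℝ (meshPoint δ xT) (edgeLanding D.carrier δ xT eT))
      (edgeLanding D.carrier δ xT eT) (meshPoint δ xT) := (IsSimpleArc.segment hqTne).symm
  have hAB : IsSimpleArc (segment ℝ (meshPoint δ xB) (edgeLanding D.carrier δ xB eB))
      (meshPoint δ xB) (edgeLanding D.carrier δ xB eB) := IsSimpleArc.segment hqBne
  have hexitM : ∀ {y : Site 2} {f : SRW.Dir 2}, meshPoint δ y ∈ D.carrier →
      ¬ segment ℝ (meshPoint δ y) (meshPoint δ (y + SRW.stepVec f)) ⊆ D.carrier →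
      ¬ (discreteDomainGraph D.carrier δ).Adj y (y + SRW.stepVec f) →
      ∀ z ∈ segment ℝ (meshPoint δ y) (edgeLanding D.carrier δ y f) ∩ meshTrace δ P',
        z = meshPoint δ y := by
    intro y f hy hyf hadj z ⟨hz, hzM⟩
    obtain ⟨a, c, he, hz'⟩ := hMseg z hzM
    have hne' : s(y, y + SRW.stepVec f) ≠ s(a, c) := fun h => hadj (by
      have h' : s(a, c) ∈ (discreteDomainGraph D.carrier δ).edgeSet := hP'edges he
      rw [← h] at h'
      exact h')
    exact (exitSegment_inter_segment D.isOpen hδ hy hyf (hle (hP'edges he)) (hsite a (hEsite he).1)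
      (hsite c (hEsite he).2) hne' hz hz').1
  have hTB : ∀ z ∈ segment ℝ (meshPoint δ xT) (edgeLanding D.carrier δ xT eT) ∩
      segment ℝ (meshPoint δ xB) (edgeLanding D.carrier δ xB eB), z = meshPoint δ xT ∧ xT = xB :=
    fun z hz => exitSegment_inter_exitSegment D.isOpen hδ hxTD hsegT hxBD hsegB hne hz.1 hz.2
  refine ⟨segment ℝ (meshPoint δ xT) (edgeLanding D.carrier δ xT eT) ∪ meshTrace δ P' ∪
    segment ℝ (meshPoint δ xB) (edgeLanding D.carrier δ xB eB), ?_, ?_,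
    Or.inl (Or.inl (left_mem_segment ℝ _ _)), ?_, ?_⟩
  · -- a simple arc from `q_T` to `q_B`
    by_cases hnil : P'.Nil
    · have hxx : xT = xB := hnil.eq
      have hed : P'.edges = [] := SimpleGraph.Walk.edges_eq_nil.2 hnil
      have hMe : meshTrace δ P' = ∅ := by
        ext z
        rw [mem_meshTrace_iff, hed]
        simp
      rw [hMe, union_empty]
      refine hAT.union (by rw [hxx]; exact hAB) fun z hz => ?_
      rw [mem_singleton_iff, (hTB z hz).1]
    · have hM : IsSimpleArc (meshTrace δ P') (meshPoint δ xT) (meshPoint δ xB) := by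
        have h := (isSimpleArc_walkTrace hP'path hnil).image
          (meshScale δ).continuous_of_finiteDimensional (meshScale_injective hδ.ne')
        rw [← meshPoint_eq_meshScale, ← meshPoint_eq_meshScale] at h
        exact h
      refine (hAT.union hM fun z hz => ?_).union hAB ?_
      · rw [mem_singleton_iff]; exact hexitM hxTD hsegT hT z hz
      · rintro z ⟨hz | hz, hz'⟩
        · obtain ⟨h1, h2⟩ := hTB z ⟨hz, hz'⟩
          rw [mem_singleton_iff, h1, h2]
        · rw [mem_singleton_iff]; exact hexitM hxBD hsegB hB z ⟨hz', hz⟩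
  · -- inside `D̄`
    have hexit : ∀ {y : Site 2} {f : SRW.Dir 2}, edgeLanding D.carrier δ y f ∈ frontier D.carrier →
        segment ℝ (meshPoint δ y) (edgeLanding D.carrier δ y f) ⊆ closure D.carrier := by
      intro y f hfr z hz
      by_cases hzq : z = edgeLanding D.carrier δ y f
      · rw [hzq]; exact frontier_subset_closure hfr
      · exact subset_closure (segment_edgeLanding_diff_subset ⟨hz, hzq⟩)
    rintro z ((hz | hz) | hz)
    · exact hexit hqTfr hz
    · obtain ⟨a, c, he, hz'⟩ := hMseg z hz
      exact (meshGraph_adj_iff.1 (discreteDomainGraph_adj_iff.1 (hP'edges he)).1).2 hz'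
    · exact hexit hqBfr hz
  · -- within `δ` of a wall site
    have hexit : ∀ {y : Site 2} {f : SRW.Dir 2},
        ∀ z ∈ segment ℝ (meshPoint δ y) (edgeLanding D.carrier δ y f), dist z (meshPoint δ y) ≤ δ := by
      intro y f z hz
      have hsub : segment ℝ (meshPoint δ y) (edgeLanding D.carrier δ y f) ⊆ closedBall (meshPoint δ y) δ :=
        (convex_closedBall _ _).segment_subset (mem_closedBall_self hδ.le)
          (mem_closedBall.2 ((dist_comm _ _).trans_le (dist_meshPoint_edgeLanding_le hδ.le)))
      exact mem_closedBall.1 (hsub hz)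
    rintro z ((hz | hz) | hz)
    · exact ⟨xT, hxTW, hexit z hz⟩
    · obtain ⟨a, c, he, hz'⟩ := hMseg z hz
      refine ⟨a, (hEsite he).1, ?_⟩
      have hca : dist (meshPoint δ c) (meshPoint δ a) ≤ δ := by
        rw [dist_comm, dist_meshPoint_of_adj (hle (hP'edges he)), abs_of_pos hδ]
      have hsub : segment ℝ (meshPoint δ a) (meshPoint δ c) ⊆ closedBall (meshPoint δ a) δ :=
        (convex_closedBall _ _).segment_subset (mem_closedBall_self hδ.le) (mem_closedBall.2 hca)
      exact mem_closedBall.1 (hsub hz')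
    · exact ⟨xB, hxBW, hexit z hz⟩
  · -- grid geometry: a kept edge meeting the wall has an end on it
    rintro a c hac ⟨z, hz', (hz | hz) | hz⟩
    · have hne' : s(xT, xT + SRW.stepVec eT) ≠ s(a, c) := fun h => hT (by
        have h' : s(a, c) ∈ (discreteDomainGraph D.carrier δ).edgeSet := hac
        rw [← h] at h'
        exact h')
      have had := discreteDomainGraph_adj_iff.1 hac
      rcases (exitSegment_inter_segment D.isOpen hδ hxTD hsegT (hle hac)
        (meshDomain_subset_meshVertices _ _ had.2.1) (meshDomain_subset_meshVertices _ _ had.2.2)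
        hne' hz hz').2 with rfl | rfl
      · exact Or.inl hxTW
      · exact Or.inr hxTW
    · -- the edge and the path, read in `ℤ²`, share a vertex
      set w₁ : (zdGraph 2).Walk a c := SimpleGraph.Walk.cons (hle hac) SimpleGraph.Walk.nil with hw₁
      have hzw : z ∈ meshTrace δ w₁ := by
        rw [mem_meshTrace_iff]
        refine ⟨s(a, c), by simp [hw₁], ?_⟩
        rw [← segment_meshPoint_eq_image]; exact hz'
      obtain ⟨x, hx₁, hx₂⟩ := exists_mem_support_of_meshTrace_inter_nonempty hδ.ne' ⟨z, hzw, hz⟩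
      have hx : x = a ∨ x = c := by simpa [hw₁] using hx₁
      rcases hx with rfl | rfl
      · exact Or.inl (hP'supp _ hx₂)
      · exact Or.inr (hP'supp _ hx₂)
    · have hne' : s(xB, xB + SRW.stepVec eB) ≠ s(a, c) := fun h => hB (by
        have h' : s(a, c) ∈ (discreteDomainGraph D.carrier δ).edgeSet := hac
        rw [← h] at h'
        exact h')
      have had := discreteDomainGraph_adj_iff.1 hac
      rcases (exitSegment_inter_segment D.isOpen hδ hxBD hsegB (hle hac)
        (meshDomain_subset_meshVertices _ _ had.2.1) (meshDomain_subset_meshVertices _ _ had.2.2)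
        hne' hz hz').2 with rfl | rfl
      · exact Or.inl hxBW
      · exact Or.inr hxBW

end Summit.CriticalPhenomena.SAWScalingLimit.Theorems.AvoidanceLimit.Anchor

end
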